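import Literature.MathematicalPhysics.QuantumFieldTheory.Balaban1983to89.B9Eq3126GreenLetters

/-!
# `Balaban1983to89.B9Eq386ResolventLetters` — T. Bałaban, *Propagators for lattice gauge theories in a background field*, Commun. Math. Phys. **99**
# (1985) 389–434 [Balaban1985BackgroundPropagators] (3.86) p. 407 with Thm 3.4 p. 400 and (3.126) p. 420: THE RESOLVENT MECHANISM «G(U′U) =
# G(U)(I − V(A)G(U))⁻¹ … a small perturbation of the operators depending on U only» AS ABSTRACT LIPSCHITZ LETTERS — two coercive operators whose
# difference is `δ`-small have inverses `γ₁⁻¹δγ₂⁻¹`-close; hence `G₁ = Δ_a⁻¹`, `K = QG₁Q†`, `K⁻¹` and `H₁ = G₁Q†K⁻¹` ((3.126)) of TWO data sets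
# are close in operator norm, with explicit constants in the coercivity `γ`, an operator bound `M`, `‖Q‖ ≤ M_Q`, a modulus `μ_Q` of `Q†` and the
# data differences `δ_Δ`, `δ_Q`

statement-level skeleton of published theorems with citation tags; proofs where landed; nothing here is a claim about the Yang–Mills mass gap

PDF held: `paper:balaban1985-cmp99-background-propagators` (journal page = PDF page + 388), pp. 400, 407, 416, 420 read by this seat (2026-08-22).

THE PRINT (first-hand, text layer of `paper:balaban1985-cmp99-background-propagators`).  p. 400, Thm 3.4: *«There exists a positive constant a₁ such that the operators G′(U), (Q′(U)G′²(U)Q′*(U))⁻¹, R(U), G(U)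
extend to configurations U′U for α₁ ≤ a₁ as analytic functions of A. The extended operators satisfy all the inequalities of Theorems 3.1-3.3
correspondingly. In fact we prove quantitative statements which are more precise, describing these analytic extensions as small perturbations
of the operators depending on U only»*; p. 407, (3.86):
*«hence V(A)G(U) is a small operator in supremum norm, and we have G(U′U) = G(U)(I − V(A)G(U))⁻¹ = Σ_{n=0}^∞ G(U)(V(A)G(U))ⁿ, (3.86) and
convergence is in the operator norm for α₁ sufficiently small»*; p. 420, (3.126): *«HB = GQ*(QGQ*)⁻¹B»*; p. 416, Thm 3.11 (positivity).
(DOCFIX, gen 81, docstring-only — statements and proofs byte-identical: the v1 header's «verbatim» quotations were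
paraphrases (reader ne9-leaf-02 g57 R-ne9leaf02-g57-1); replaced by the text layer's words, read first-hand.)

WHY THIS FILE (cell context).  The pub-balaban NE9 chain has, at every small field `U` of a fixed lattice, the letters `G₁(U)`, `K(U)⁻¹ =
(Q(U)G₁(U)Q(U)†)⁻¹`, `H₁(U)` bounded UNIFORMLY (`B9Eq3126GreenLetters` / `B9Eq3126H1Bound`).  The next display toward the curve species as a
FAMILY in the background is CONTINUITY IN `U`: the first-resolvent identity `T₁⁻¹ − T₂⁻¹ = T₁⁻¹(T₂ − T₁)T₂⁻¹` — the finite-dimensional core of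
(3.86)'s Neumann series — turns the remainder bounds of `B9Eq373DerivativeRemainderL2` / `B9Thm311SmallFieldCoercivity` (Δ_a(U) − Δ_a(1) small) and
NE9 leaf-04's `δ_Q` (Q(U) − Q(1) small) into operator-norm closeness of `G₁`, `K⁻¹`, `H₁`.  This file is the ABSTRACT algebra; the instantiation
at the chain's letters is a separate file.

WHAT IS PROVED (sorry-free; [folklore] finite-dimensional resolvent algebra; no `Prop` placeholder; no inequality of the paper asserted).
* **`norm_greenK_sub_greenK_le`** — two operators with positive-definite real parts, `γ_i`-coercive, with `‖T₂x − T₁x‖ ≤ δ‖x‖`: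
  `‖T₁⁻¹y − T₂⁻¹y‖ ≤ γ₁⁻¹δγ₂⁻¹‖y‖` (`T₁⁻¹ − T₂⁻¹ = T₁⁻¹(T₂ − T₁)T₂⁻¹`).
* **`norm_G1K_sub_le`** — for two Sect. D data sets with `Δ_a`'s `γ`-coercive and `δ_Δ`-close: `‖G₁⁽¹⁾z − G₁⁽²⁾z‖ ≤ γ⁻¹δ_Δγ⁻¹‖z‖`.
* **`norm_K_sub_le`** — `‖K⁽²⁾y − K⁽¹⁾y‖ ≤ (δ_Qγ⁻¹M_Q + M_Qγ⁻¹δ_Δγ⁻¹M_Q + M_Qγ⁻¹δ_Q)‖y‖` for `K = QG₁Q†` (`‖Q_i‖ ≤ M_Q`, `‖Q₂ − Q₁‖ ≤ δ_Q`; adjoint transfer).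
* **`norm_KinvK_sub_le`** — `‖K⁽¹⁾⁻¹y − K⁽²⁾⁻¹y‖ ≤ κ⁻¹δ_Kκ⁻¹‖y‖`, `κ = γμ_Q²/M²` the coercivity of `K` (`B9Eq3126GreenLetters.re_inner_K_ge`).
* **`norm_H1K_sub_le`** — `‖H₁⁽¹⁾b − H₁⁽²⁾b‖ ≤ (γ⁻¹δ_Δγ⁻¹·M_Qκ⁻¹ + γ⁻¹δ_Qκ⁻¹ + γ⁻¹M_Qκ⁻¹δ_Kκ⁻¹)‖b‖` for `H₁ = G₁Q†K⁻¹` ((3.126)).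
* **`norm_frakG_formula_sub_le`** — the telescoping of the formula `𝔊 = G₁ − H₁QG₁ − G₁DRD*G₁` ((3.153) with `G₁Q†K⁻¹ = H₁`) of two data sets from
  bounds and differences of `G₁, H₁, Q, D, D*, R` (pure normed-space algebra; the `𝔊`-letter's Lipschitz bound once `R(U)`'s is available).
MODEL / HONEST SCOPE.  Abstract finite-dimensional `𝕜`-Hilbert letters as in `B11Eq103H1Complex` §2; the mechanism of (3.86) at the level of
ONE resolvent step (no Neumann series needed in finite dimension: both inverses exist by positivity); NOT print's uniform statement, NOT
analyticity in `A`; NOT summit progress (cell pub-balaban: NE9 NOT PRINTED / NOT PROVED; spine PROVED 0/9).  Filed by the pub-balaban NE9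
BINDER-row owner lineage `b2b-balaban-t4-ne9-p1` (gen 81); NEW file importing `B9Eq3126GreenLetters` only; nothing modified.  Net new unproved facts: 0.
-/

noncomputable section

open scoped InnerProductSpace

namespace Literature.MathematicalPhysics.QuantumFieldTheory.Balaban1983to89.B9Eq386ResolventLetters

open B11Eq103H1Complex (laplaceAK greenK apply_greenK greenK_apply G1K KinvK H1K laplaceAK_G1K)
open B9Eq373DerivativeRemainderL2 (norm_adjoint_apply_le)
open B9Eq3126GreenLetters (norm_greenK_le re_inner_K_ge)

/-! ## §1 Two coercive operators with a small difference have close inverses -/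

section Green

variable {𝕜 : Type*} [RCLike 𝕜] {E : Type*} [NormedAddCommGroup E] [InnerProductSpace 𝕜 E] [FiniteDimensional 𝕜 E]

/-- **THE RESOLVENT STEP OF (3.86)**: `T₁⁻¹y − T₂⁻¹y = T₁⁻¹((T₂ − T₁)T₂⁻¹y)`, hence `‖T₁⁻¹y − T₂⁻¹y‖ ≤ γ₁⁻¹·δ·γ₂⁻¹·‖y‖` for `γ_i`-coercive `T_i` with
`‖T₂x − T₁x‖ ≤ δ‖x‖` — «a small perturbation of the operators depending on U only». [cite: Balaban1985BackgroundPropagators, (3.86) p.407, Thm 3.4 p.400] -/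
theorem norm_greenK_sub_greenK_le {T₁ T₂ : E →ₗ[𝕜] E} {γ₁ γ₂ δ : ℝ} (hγ₁ : 0 < γ₁) (hγ₂ : 0 < γ₂)
    (hc₁ : ∀ x : E, γ₁ * ‖x‖ ^ 2 ≤ RCLike.re ⟪x, T₁ x⟫_𝕜) (hc₂ : ∀ x : E, γ₂ * ‖x‖ ^ 2 ≤ RCLike.re ⟪x, T₂ x⟫_𝕜)
    (h₁ : ∀ x : E, x ≠ 0 → 0 < RCLike.re ⟪x, T₁ x⟫_𝕜) (h₂ : ∀ x : E, x ≠ 0 → 0 < RCLike.re ⟪x, T₂ x⟫_𝕜)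
    (hδ0 : 0 ≤ δ) (hδ : ∀ x : E, ‖T₂ x - T₁ x‖ ≤ δ * ‖x‖) (y : E) :
    ‖greenK T₁ h₁ y - greenK T₂ h₂ y‖ ≤ γ₁⁻¹ * δ * γ₂⁻¹ * ‖y‖ := by
  have key : greenK T₁ h₁ y - greenK T₂ h₂ y = greenK T₁ h₁ (T₂ (greenK T₂ h₂ y) - T₁ (greenK T₂ h₂ y)) := by
    rw [map_sub, apply_greenK h₂, greenK_apply h₁]
  rw [key]
  calc ‖greenK T₁ h₁ (T₂ (greenK T₂ h₂ y) - T₁ (greenK T₂ h₂ y))‖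
      ≤ γ₁⁻¹ * ‖T₂ (greenK T₂ h₂ y) - T₁ (greenK T₂ h₂ y)‖ := norm_greenK_le hγ₁ hc₁ h₁ _
    _ ≤ γ₁⁻¹ * (δ * ‖greenK T₂ h₂ y‖) := mul_le_mul_of_nonneg_left (hδ _) (by positivity)
    _ ≤ γ₁⁻¹ * (δ * (γ₂⁻¹ * ‖y‖)) :=
        mul_le_mul_of_nonneg_left (mul_le_mul_of_nonneg_left (norm_greenK_le hγ₂ hc₂ h₂ y) hδ0) (by positivity)
    _ = γ₁⁻¹ * δ * γ₂⁻¹ * ‖y‖ := by ring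

end Green

/-! ## §2 Two Sect. D data sets: `G₁`, `K = QG₁Q†`, `K⁻¹`, `H₁ = G₁Q†K⁻¹` are close -/

section TwoData

variable {𝕜 : Type*} [RCLike 𝕜] {E : Type*} [NormedAddCommGroup E] [InnerProductSpace 𝕜 E] [FiniteDimensional 𝕜 E]
  {F : Type*} [NormedAddCommGroup F] [InnerProductSpace 𝕜 F] [FiniteDimensional 𝕜 F] {S : Type*} [NormedAddCommGroup S] [InnerProductSpace 𝕜 S]
  {Δ₁ Δ₂ : E →ₗ[𝕜] E} {D₁ D₂ : S →ₗ[𝕜] E} {R₁ R₂ : S →ₗ[𝕜] S} {Ds₁ Ds₂ : E →ₗ[𝕜] S} {Q₁ Q₂ : E →ₗ[𝕜] F} {a : 𝕜}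
  {γ MT δT : ℝ} (hγ : 0 < γ)
  (hcoer₁ : ∀ x : E, γ * ‖x‖ ^ 2 ≤ RCLike.re ⟪x, laplaceAK Δ₁ D₁ R₁ Ds₁ Q₁ (LinearMap.adjoint Q₁) a x⟫_𝕜)
  (hcoer₂ : ∀ x : E, γ * ‖x‖ ^ 2 ≤ RCLike.re ⟪x, laplaceAK Δ₂ D₂ R₂ Ds₂ Q₂ (LinearMap.adjoint Q₂) a x⟫_𝕜)
  (hMT₁ : ∀ x : E, ‖laplaceAK Δ₁ D₁ R₁ Ds₁ Q₁ (LinearMap.adjoint Q₁) a x‖ ≤ MT * ‖x‖)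
  (hMT₂ : ∀ x : E, ‖laplaceAK Δ₂ D₂ R₂ Ds₂ Q₂ (LinearMap.adjoint Q₂) a x‖ ≤ MT * ‖x‖)
  (hpos₁ : ∀ x : E, x ≠ 0 → 0 < RCLike.re ⟪x, laplaceAK Δ₁ D₁ R₁ Ds₁ Q₁ (LinearMap.adjoint Q₁) a x⟫_𝕜)
  (hpos₂ : ∀ x : E, x ≠ 0 → 0 < RCLike.re ⟪x, laplaceAK Δ₂ D₂ R₂ Ds₂ Q₂ (LinearMap.adjoint Q₂) a x⟫_𝕜)
  (hδT0 : 0 ≤ δT)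
  (hδT : ∀ x : E, ‖laplaceAK Δ₂ D₂ R₂ Ds₂ Q₂ (LinearMap.adjoint Q₂) a x - laplaceAK Δ₁ D₁ R₁ Ds₁ Q₁ (LinearMap.adjoint Q₁) a x‖ ≤ δT * ‖x‖)

include hγ hcoer₁ hcoer₂ hδT0 hδT in
/-- **`G₁` OF TWO DATA SETS ARE CLOSE**: `‖G₁⁽¹⁾z − G₁⁽²⁾z‖ ≤ γ⁻¹·δ_Δ·γ⁻¹·‖z‖` when both `Δ_a`'s are `γ`-coercive and `δ_Δ`-close — (3.86)'s first
consequence «G(U′U) … a small perturbation of G(U)» at a fixed lattice. [cite: Balaban1985BackgroundPropagators, (3.86) p.407, Thm 3.4 p.400] -/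
theorem norm_G1K_sub_le (z : E) :
    ‖G1K Δ₁ D₁ R₁ Ds₁ Q₁ (LinearMap.adjoint Q₁) a hpos₁ z - G1K Δ₂ D₂ R₂ Ds₂ Q₂ (LinearMap.adjoint Q₂) a hpos₂ z‖ ≤ γ⁻¹ * δT * γ⁻¹ * ‖z‖ := by
  unfold G1K
  exact norm_greenK_sub_greenK_le hγ hγ hcoer₁ hcoer₂ hpos₁ hpos₂ hδT0 hδT z

variable {MQ μQ δQ : ℝ} (hMQ : 0 ≤ MQ) (hμQ : 0 < μQ) (hδQ0 : 0 ≤ δQ)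
  (hQ₁ : ∀ x : E, ‖Q₁ x‖ ≤ MQ * ‖x‖) (hQ₂ : ∀ x : E, ‖Q₂ x‖ ≤ MQ * ‖x‖)
  (hQadj₁ : ∀ y : F, μQ * ‖y‖ ≤ ‖LinearMap.adjoint Q₁ y‖) (hQadj₂ : ∀ y : F, μQ * ‖y‖ ≤ ‖LinearMap.adjoint Q₂ y‖)
  (hδQ : ∀ x : E, ‖Q₂ x - Q₁ x‖ ≤ δQ * ‖x‖)
  (hadj₁ : ∀ (x : E) (y : F), ⟪Q₁ x, y⟫_𝕜 = ⟪x, LinearMap.adjoint Q₁ y⟫_𝕜) (hinj₁ : Function.Injective (LinearMap.adjoint Q₁))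
  (hadj₂ : ∀ (x : E) (y : F), ⟪Q₂ x, y⟫_𝕜 = ⟪x, LinearMap.adjoint Q₂ y⟫_𝕜) (hinj₂ : Function.Injective (LinearMap.adjoint Q₂))

include hδQ0 hδQ in
/-- adjoint transfer of the difference: `‖Q₂†y − Q₁†y‖ ≤ δ_Q‖y‖`. [cite: Balaban1985BackgroundPropagators, (3.19) p.393] -/
theorem norm_adjoint_sub_le (y : F) : ‖LinearMap.adjoint Q₂ y - LinearMap.adjoint Q₁ y‖ ≤ δQ * ‖y‖ := by
  have h := norm_adjoint_apply_le (Q₂ - Q₁) hδQ0 (fun x => by rw [LinearMap.sub_apply]; exact hδQ x) y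
  rwa [map_sub, LinearMap.sub_apply] at h

include hγ hcoer₁ hcoer₂ hδT0 hδT hMQ hδQ0 hδQ hQ₁ hQ₂ in
/-- **`K = QG₁Q†` OF TWO DATA SETS ARE CLOSE**: telescoping `Q₂G₂Q₂† − Q₁G₁Q₁† = (Q₂−Q₁)G₂Q₂† + Q₁(G₂−G₁)Q₂† + Q₁G₁(Q₂†−Q₁†)` with `‖G_i‖ ≤ γ⁻¹`,
`‖Q_i‖, ‖Q_i†‖ ≤ M_Q`. [cite: Balaban1985BackgroundPropagators, (3.86) p.407, (3.126) p.420; Balaban1985Variational, (45) p.285] -/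
theorem norm_K_sub_le (y : F) :
    ‖(Q₂ ∘ₗ G1K Δ₂ D₂ R₂ Ds₂ Q₂ (LinearMap.adjoint Q₂) a hpos₂ ∘ₗ LinearMap.adjoint Q₂) y -
        (Q₁ ∘ₗ G1K Δ₁ D₁ R₁ Ds₁ Q₁ (LinearMap.adjoint Q₁) a hpos₁ ∘ₗ LinearMap.adjoint Q₁) y‖ ≤
      (δQ * (γ⁻¹ * MQ) + MQ * (γ⁻¹ * δT * γ⁻¹ * MQ) + MQ * (γ⁻¹ * δQ)) * ‖y‖ := by
  set G₁ := G1K Δ₁ D₁ R₁ Ds₁ Q₁ (LinearMap.adjoint Q₁) a hpos₁ with hG₁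
  set G₂ := G1K Δ₂ D₂ R₂ Ds₂ Q₂ (LinearMap.adjoint Q₂) a hpos₂ with hG₂
  have hG₁le : ∀ z, ‖G₁ z‖ ≤ γ⁻¹ * ‖z‖ := fun z => by rw [hG₁]; unfold G1K; exact norm_greenK_le hγ hcoer₁ hpos₁ z
  have hG₂le : ∀ z, ‖G₂ z‖ ≤ γ⁻¹ * ‖z‖ := fun z => by rw [hG₂]; unfold G1K; exact norm_greenK_le hγ hcoer₂ hpos₂ z
  have hGsub : ∀ z, ‖G₁ z - G₂ z‖ ≤ γ⁻¹ * δT * γ⁻¹ * ‖z‖ := fun z => by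
    rw [hG₁, hG₂]; exact norm_G1K_sub_le hγ hcoer₁ hcoer₂ hpos₁ hpos₂ hδT0 hδT z
  have hQa₂ : ∀ y, ‖LinearMap.adjoint Q₂ y‖ ≤ MQ * ‖y‖ := norm_adjoint_apply_le Q₂ hMQ hQ₂
  have hQasub := norm_adjoint_sub_le hδQ0 hδQ
  simp only [LinearMap.comp_apply]
  -- telescoping
  have hsplit : Q₂ (G₂ (LinearMap.adjoint Q₂ y)) - Q₁ (G₁ (LinearMap.adjoint Q₁ y)) =
      (Q₂ (G₂ (LinearMap.adjoint Q₂ y)) - Q₁ (G₂ (LinearMap.adjoint Q₂ y))) +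
        Q₁ (G₂ (LinearMap.adjoint Q₂ y) - G₁ (LinearMap.adjoint Q₂ y)) +
        Q₁ (G₁ (LinearMap.adjoint Q₂ y - LinearMap.adjoint Q₁ y)) := by
    simp only [map_sub]; abel
  rw [hsplit]
  have h1 : ‖Q₂ (G₂ (LinearMap.adjoint Q₂ y)) - Q₁ (G₂ (LinearMap.adjoint Q₂ y))‖ ≤ δQ * (γ⁻¹ * MQ) * ‖y‖ := by
    calc _ ≤ δQ * ‖G₂ (LinearMap.adjoint Q₂ y)‖ := hδQ _
      _ ≤ δQ * (γ⁻¹ * (MQ * ‖y‖)) :=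
          mul_le_mul_of_nonneg_left ((hG₂le _).trans (mul_le_mul_of_nonneg_left (hQa₂ y) (by positivity))) hδQ0
      _ = δQ * (γ⁻¹ * MQ) * ‖y‖ := by ring
  have h2 : ‖Q₁ (G₂ (LinearMap.adjoint Q₂ y) - G₁ (LinearMap.adjoint Q₂ y))‖ ≤ MQ * (γ⁻¹ * δT * γ⁻¹ * MQ) * ‖y‖ := by
    refine (hQ₁ _).trans ?_
    rw [mul_assoc]
    refine mul_le_mul_of_nonneg_left ?_ hMQ
    rw [← neg_sub, norm_neg]
    calc ‖G₁ (LinearMap.adjoint Q₂ y) - G₂ (LinearMap.adjoint Q₂ y)‖ ≤ γ⁻¹ * δT * γ⁻¹ * ‖LinearMap.adjoint Q₂ y‖ := hGsub _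
      _ ≤ γ⁻¹ * δT * γ⁻¹ * (MQ * ‖y‖) := mul_le_mul_of_nonneg_left (hQa₂ y) (by positivity)
      _ = γ⁻¹ * δT * γ⁻¹ * MQ * ‖y‖ := by ring
  have h3 : ‖Q₁ (G₁ (LinearMap.adjoint Q₂ y - LinearMap.adjoint Q₁ y))‖ ≤ MQ * (γ⁻¹ * δQ) * ‖y‖ := by
    refine (hQ₁ _).trans ?_
    rw [mul_assoc]
    refine mul_le_mul_of_nonneg_left ?_ hMQ
    calc ‖G₁ (LinearMap.adjoint Q₂ y - LinearMap.adjoint Q₁ y)‖ ≤ γ⁻¹ * ‖LinearMap.adjoint Q₂ y - LinearMap.adjoint Q₁ y‖ := hG₁le _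
      _ ≤ γ⁻¹ * (δQ * ‖y‖) := mul_le_mul_of_nonneg_left (hQasub y) (by positivity)
      _ = γ⁻¹ * δQ * ‖y‖ := by ring
  calc _ ≤ ‖Q₂ (G₂ (LinearMap.adjoint Q₂ y)) - Q₁ (G₂ (LinearMap.adjoint Q₂ y))‖ +
        ‖Q₁ (G₂ (LinearMap.adjoint Q₂ y) - G₁ (LinearMap.adjoint Q₂ y))‖ +
        ‖Q₁ (G₁ (LinearMap.adjoint Q₂ y - LinearMap.adjoint Q₁ y))‖ := norm_add₃_le
    _ ≤ δQ * (γ⁻¹ * MQ) * ‖y‖ + MQ * (γ⁻¹ * δT * γ⁻¹ * MQ) * ‖y‖ + MQ * (γ⁻¹ * δQ) * ‖y‖ := add_le_add (add_le_add h1 h2) h3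
    _ = _ := by ring

include hγ hcoer₁ hcoer₂ hδT0 hδT hMQ hδQ0 hδQ hQ₁ hQ₂ hMT₁ hMT₂ hμQ hQadj₁ hQadj₂ in
/-- **`K⁻¹ = (QG₁Q†)⁻¹` OF TWO DATA SETS ARE CLOSE**: both `K`'s are `κ`-coercive with `κ = γμ_Q²/M²` (`re_inner_K_ge`), and `δ_K`-close by
`norm_K_sub_le`; the resolvent step gives `‖K⁽¹⁾⁻¹y − K⁽²⁾⁻¹y‖ ≤ κ⁻¹·δ_K·κ⁻¹·‖y‖`. [cite: Balaban1985BackgroundPropagators, (3.86) p.407, Thm 3.4 p.400; Balaban1985Variational, (45) p.285] -/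
theorem norm_KinvK_sub_le (hMT0 : 0 < MT) (y : F) :
    ‖KinvK (Δ := Δ₁) (D := D₁) (R := R₁) (Dstar := Ds₁) (Q := Q₁) (Qadj := LinearMap.adjoint Q₁) (a := a) hpos₁ hadj₁ hinj₁ y -
        KinvK (Δ := Δ₂) (D := D₂) (R := R₂) (Dstar := Ds₂) (Q := Q₂) (Qadj := LinearMap.adjoint Q₂) (a := a) hpos₂ hadj₂ hinj₂ y‖ ≤
      (γ * μQ ^ 2 / MT ^ 2)⁻¹ * (δQ * (γ⁻¹ * MQ) + MQ * (γ⁻¹ * δT * γ⁻¹ * MQ) + MQ * (γ⁻¹ * δQ)) * (γ * μQ ^ 2 / MT ^ 2)⁻¹ * ‖y‖ := by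
  unfold KinvK
  exact norm_greenK_sub_greenK_le (by positivity) (by positivity) (re_inner_K_ge hγ hcoer₁ hMT₁ hpos₁ hμQ hQadj₁)
    (re_inner_K_ge hγ hcoer₂ hMT₂ hpos₂ hμQ hQadj₂) _ _ (by positivity)
    (norm_K_sub_le hγ hcoer₁ hcoer₂ hpos₁ hpos₂ hδT0 hδT hMQ hδQ0 hQ₁ hQ₂ hδQ) y

include hγ hcoer₁ hcoer₂ hδT0 hδT hMQ hδQ0 hδQ hQ₁ hQ₂ hMT₁ hMT₂ hμQ hQadj₁ hQadj₂ in
/-- **`H₁ = G₁Q†(QG₁Q†)⁻¹` ((3.126)) OF TWO DATA SETS ARE CLOSE**: telescoping `G₁Q₁†K₁⁻¹ − G₂Q₂†K₂⁻¹ = (G₁−G₂)Q₁†K₁⁻¹ + G₂(Q₁†−Q₂†)K₁⁻¹ +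
G₂Q₂†(K₁⁻¹−K₂⁻¹)` with the bounds `‖G_i‖ ≤ γ⁻¹`, `‖Q_i†‖ ≤ M_Q`, `‖K_i⁻¹‖ ≤ κ⁻¹` and the three differences — (3.86)'s «small perturbation» for the
operator `H` of (3.126) at a fixed lattice. [cite: Balaban1985BackgroundPropagators, (3.126) p.420, (3.86) p.407, Thm 3.4 p.400; Balaban1985Variational, (45) p.285, (103) p.293] -/
theorem norm_H1K_sub_le (hMT0 : 0 < MT) (b : F) :
    ‖H1K (Δ := Δ₁) (D := D₁) (R := R₁) (Dstar := Ds₁) (Q := Q₁) (Qadj := LinearMap.adjoint Q₁) (a := a) hpos₁ hadj₁ hinj₁ b -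
        H1K (Δ := Δ₂) (D := D₂) (R := R₂) (Dstar := Ds₂) (Q := Q₂) (Qadj := LinearMap.adjoint Q₂) (a := a) hpos₂ hadj₂ hinj₂ b‖ ≤
      (γ⁻¹ * δT * γ⁻¹ * (MQ * (γ * μQ ^ 2 / MT ^ 2)⁻¹) + γ⁻¹ * (δQ * (γ * μQ ^ 2 / MT ^ 2)⁻¹) +
        γ⁻¹ * (MQ * ((γ * μQ ^ 2 / MT ^ 2)⁻¹ * (δQ * (γ⁻¹ * MQ) + MQ * (γ⁻¹ * δT * γ⁻¹ * MQ) + MQ * (γ⁻¹ * δQ)) *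
          (γ * μQ ^ 2 / MT ^ 2)⁻¹))) * ‖b‖ := by
  set G₁ := G1K Δ₁ D₁ R₁ Ds₁ Q₁ (LinearMap.adjoint Q₁) a hpos₁ with hG₁
  set G₂ := G1K Δ₂ D₂ R₂ Ds₂ Q₂ (LinearMap.adjoint Q₂) a hpos₂ with hG₂
  set K₁ := KinvK (Δ := Δ₁) (D := D₁) (R := R₁) (Dstar := Ds₁) (Q := Q₁) (Qadj := LinearMap.adjoint Q₁) (a := a) hpos₁ hadj₁ hinj₁ with hK₁
  set K₂ := KinvK (Δ := Δ₂) (D := D₂) (R := R₂) (Dstar := Ds₂) (Q := Q₂) (Qadj := LinearMap.adjoint Q₂) (a := a) hpos₂ hadj₂ hinj₂ with hK₂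
  set κ : ℝ := γ * μQ ^ 2 / MT ^ 2 with hκ
  have hκ0 : 0 < κ := by positivity
  have hG₁le : ∀ z, ‖G₁ z‖ ≤ γ⁻¹ * ‖z‖ := fun z => by rw [hG₁]; unfold G1K; exact norm_greenK_le hγ hcoer₁ hpos₁ z
  have hG₂le : ∀ z, ‖G₂ z‖ ≤ γ⁻¹ * ‖z‖ := fun z => by rw [hG₂]; unfold G1K; exact norm_greenK_le hγ hcoer₂ hpos₂ z
  have hGsub : ∀ z, ‖G₁ z - G₂ z‖ ≤ γ⁻¹ * δT * γ⁻¹ * ‖z‖ := fun z => by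
    rw [hG₁, hG₂]; exact norm_G1K_sub_le hγ hcoer₁ hcoer₂ hpos₁ hpos₂ hδT0 hδT z
  have hQa₁ : ∀ y, ‖LinearMap.adjoint Q₁ y‖ ≤ MQ * ‖y‖ := norm_adjoint_apply_le Q₁ hMQ hQ₁
  have hQa₂ : ∀ y, ‖LinearMap.adjoint Q₂ y‖ ≤ MQ * ‖y‖ := norm_adjoint_apply_le Q₂ hMQ hQ₂
  have hQasub : ∀ y, ‖LinearMap.adjoint Q₁ y - LinearMap.adjoint Q₂ y‖ ≤ δQ * ‖y‖ := fun y => by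
    rw [← neg_sub, norm_neg]; exact norm_adjoint_sub_le hδQ0 hδQ y
  have hK₁le : ∀ y, ‖K₁ y‖ ≤ κ⁻¹ * ‖y‖ := fun y => by
    rw [hK₁, hκ]; exact B9Eq3126GreenLetters.norm_KinvK_le hγ hcoer₁ hMT₁ hpos₁ hμQ hQadj₁ hadj₁ hinj₁ hMT0 y
  have hKsub : ∀ y, ‖K₁ y - K₂ y‖ ≤ κ⁻¹ * (δQ * (γ⁻¹ * MQ) + MQ * (γ⁻¹ * δT * γ⁻¹ * MQ) + MQ * (γ⁻¹ * δQ)) * κ⁻¹ * ‖y‖ := fun y => by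
    rw [hK₁, hK₂, hκ]
    exact norm_KinvK_sub_le hγ hcoer₁ hcoer₂ hMT₁ hMT₂ hpos₁ hpos₂ hδT0 hδT hMQ hμQ hδQ0 hQ₁ hQ₂ hQadj₁ hQadj₂ hδQ hadj₁ hinj₁ hadj₂ hinj₂ hMT0 y
  have hδK0 : 0 ≤ κ⁻¹ * (δQ * (γ⁻¹ * MQ) + MQ * (γ⁻¹ * δT * γ⁻¹ * MQ) + MQ * (γ⁻¹ * δQ)) * κ⁻¹ := by positivity
  -- `H₁ = G₁ ∘ Q† ∘ K⁻¹`
  have hH₁ : H1K (Δ := Δ₁) (D := D₁) (R := R₁) (Dstar := Ds₁) (Q := Q₁) (Qadj := LinearMap.adjoint Q₁) (a := a) hpos₁ hadj₁ hinj₁ b =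
      G₁ (LinearMap.adjoint Q₁ (K₁ b)) := rfl
  have hH₂ : H1K (Δ := Δ₂) (D := D₂) (R := R₂) (Dstar := Ds₂) (Q := Q₂) (Qadj := LinearMap.adjoint Q₂) (a := a) hpos₂ hadj₂ hinj₂ b =
      G₂ (LinearMap.adjoint Q₂ (K₂ b)) := rfl
  rw [hH₁, hH₂]
  have hsplit : G₁ (LinearMap.adjoint Q₁ (K₁ b)) - G₂ (LinearMap.adjoint Q₂ (K₂ b)) =
      (G₁ (LinearMap.adjoint Q₁ (K₁ b)) - G₂ (LinearMap.adjoint Q₁ (K₁ b))) +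
        G₂ (LinearMap.adjoint Q₁ (K₁ b) - LinearMap.adjoint Q₂ (K₁ b)) +
        G₂ (LinearMap.adjoint Q₂ (K₁ b - K₂ b)) := by
    simp only [map_sub]; abel
  rw [hsplit]
  have h1 : ‖G₁ (LinearMap.adjoint Q₁ (K₁ b)) - G₂ (LinearMap.adjoint Q₁ (K₁ b))‖ ≤ γ⁻¹ * δT * γ⁻¹ * (MQ * κ⁻¹) * ‖b‖ := by
    refine (hGsub _).trans ?_
    rw [mul_assoc (γ⁻¹ * δT * γ⁻¹)]
    refine mul_le_mul_of_nonneg_left ?_ (by positivity)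
    calc ‖LinearMap.adjoint Q₁ (K₁ b)‖ ≤ MQ * ‖K₁ b‖ := hQa₁ _
      _ ≤ MQ * (κ⁻¹ * ‖b‖) := mul_le_mul_of_nonneg_left (hK₁le b) hMQ
      _ = MQ * κ⁻¹ * ‖b‖ := by ring
  have h2 : ‖G₂ (LinearMap.adjoint Q₁ (K₁ b) - LinearMap.adjoint Q₂ (K₁ b))‖ ≤ γ⁻¹ * (δQ * κ⁻¹) * ‖b‖ := by
    refine (hG₂le _).trans ?_
    rw [mul_assoc]
    refine mul_le_mul_of_nonneg_left ?_ (by positivity)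
    calc ‖LinearMap.adjoint Q₁ (K₁ b) - LinearMap.adjoint Q₂ (K₁ b)‖ ≤ δQ * ‖K₁ b‖ := hQasub _
      _ ≤ δQ * (κ⁻¹ * ‖b‖) := mul_le_mul_of_nonneg_left (hK₁le b) hδQ0
      _ = δQ * κ⁻¹ * ‖b‖ := by ring
  have h3 : ‖G₂ (LinearMap.adjoint Q₂ (K₁ b - K₂ b))‖ ≤
      γ⁻¹ * (MQ * (κ⁻¹ * (δQ * (γ⁻¹ * MQ) + MQ * (γ⁻¹ * δT * γ⁻¹ * MQ) + MQ * (γ⁻¹ * δQ)) * κ⁻¹)) * ‖b‖ := by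
    refine (hG₂le _).trans ?_
    rw [mul_assoc]
    refine mul_le_mul_of_nonneg_left ?_ (by positivity)
    calc ‖LinearMap.adjoint Q₂ (K₁ b - K₂ b)‖ ≤ MQ * ‖K₁ b - K₂ b‖ := hQa₂ _
      _ ≤ MQ * (κ⁻¹ * (δQ * (γ⁻¹ * MQ) + MQ * (γ⁻¹ * δT * γ⁻¹ * MQ) + MQ * (γ⁻¹ * δQ)) * κ⁻¹ * ‖b‖) :=
          mul_le_mul_of_nonneg_left (hKsub b) hMQ
      _ = _ := by ring
  calc _ ≤ ‖G₁ (LinearMap.adjoint Q₁ (K₁ b)) - G₂ (LinearMap.adjoint Q₁ (K₁ b))‖ +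
        ‖G₂ (LinearMap.adjoint Q₁ (K₁ b) - LinearMap.adjoint Q₂ (K₁ b))‖ + ‖G₂ (LinearMap.adjoint Q₂ (K₁ b - K₂ b))‖ := norm_add₃_le
    _ ≤ γ⁻¹ * δT * γ⁻¹ * (MQ * κ⁻¹) * ‖b‖ + γ⁻¹ * (δQ * κ⁻¹) * ‖b‖ +
        γ⁻¹ * (MQ * (κ⁻¹ * (δQ * (γ⁻¹ * MQ) + MQ * (γ⁻¹ * δT * γ⁻¹ * MQ) + MQ * (γ⁻¹ * δQ)) * κ⁻¹)) * ‖b‖ :=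
        add_le_add (add_le_add h1 h2) h3
    _ = _ := by rw [hκ]; ring

end TwoData

/-! ## §3 The `𝔊 = G₁𝔓*`-formula ((3.153)/(111)) of two data sets: telescoping -/

section FrakG

variable {𝕜 : Type*} [RCLike 𝕜] {E : Type*} [NormedAddCommGroup E] [NormedSpace 𝕜 E] {F : Type*} [NormedAddCommGroup F] [NormedSpace 𝕜 F]
  {S : Type*} [NormedAddCommGroup S] [NormedSpace 𝕜 S]

/-- **`𝔊 = G₁ − H₁QG₁ − G₁DRD*G₁` ((3.153) `𝔊 = G₁𝔓*` with `G₁Q†K⁻¹ = H₁`) OF TWO DATA SETS ARE CLOSE** — pure telescoping: given bounds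
`‖G_i‖ ≤ C_G`, `‖H⁽²⁾‖ ≤ C_H`, `‖Q_i‖ ≤ M_Q`, `‖D_i‖, ‖D*_i‖ ≤ M_D`, `‖R_i‖ ≤ 1` and differences `δ_G, δ_H, δ_Q, δ_D, δ_R` (for `G`, `H₁`, `Q`, `D`/`D*`, `R`),
the two values of the formula at `x` differ by at most
`(δ_G + (δ_HM_QC_G + C_Hδ_QC_G + C_HM_Qδ_G) + (δ_GM_D²C_G + C_Gδ_DM_DC_G + C_GM_Dδ_RM_DC_G + C_GM_Dδ_DC_G + C_GM_D²δ_G))‖x‖`.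
[cite: Balaban1985BackgroundPropagators, (3.153) p.426, (3.147) p.425, (3.86) p.407; Balaban1985Variational, (110)–(111) p.294] -/
theorem norm_frakG_formula_sub_le (G₁ G₂ : E →ₗ[𝕜] E) (H₁ H₂ : F →ₗ[𝕜] E) (Q₁ Q₂ : E →ₗ[𝕜] F) (D₁ D₂ : S →ₗ[𝕜] E) (R₁ R₂ : S →ₗ[𝕜] S)
    (Ds₁ Ds₂ : E →ₗ[𝕜] S) {CG CH MQ MD δG δH δQ δD δR : ℝ} (hCG : 0 ≤ CG) (hCH : 0 ≤ CH) (hMQ : 0 ≤ MQ) (hMD : 0 ≤ MD)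
    (hδG0 : 0 ≤ δG) (hδH0 : 0 ≤ δH) (hδQ0 : 0 ≤ δQ) (hδD0 : 0 ≤ δD) (hδR0 : 0 ≤ δR)
    (hG₁ : ∀ z, ‖G₁ z‖ ≤ CG * ‖z‖) (hG₂ : ∀ z, ‖G₂ z‖ ≤ CG * ‖z‖) (hH₂ : ∀ b, ‖H₂ b‖ ≤ CH * ‖b‖)
    (hQ₁ : ∀ z, ‖Q₁ z‖ ≤ MQ * ‖z‖) (hQ₂ : ∀ z, ‖Q₂ z‖ ≤ MQ * ‖z‖) (hD₁ : ∀ s, ‖D₁ s‖ ≤ MD * ‖s‖) (hD₂ : ∀ s, ‖D₂ s‖ ≤ MD * ‖s‖)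
    (hDs₁ : ∀ z, ‖Ds₁ z‖ ≤ MD * ‖z‖) (hDs₂ : ∀ z, ‖Ds₂ z‖ ≤ MD * ‖z‖) (hR₁ : ∀ s, ‖R₁ s‖ ≤ ‖s‖) (hR₂ : ∀ s, ‖R₂ s‖ ≤ ‖s‖)
    (hδG : ∀ z, ‖G₁ z - G₂ z‖ ≤ δG * ‖z‖) (hδH : ∀ b, ‖H₁ b - H₂ b‖ ≤ δH * ‖b‖) (hδQ : ∀ z, ‖Q₁ z - Q₂ z‖ ≤ δQ * ‖z‖)
    (hδD : ∀ s, ‖D₁ s - D₂ s‖ ≤ δD * ‖s‖) (hδDs : ∀ z, ‖Ds₁ z - Ds₂ z‖ ≤ δD * ‖z‖) (hδR : ∀ s, ‖R₁ s - R₂ s‖ ≤ δR * ‖s‖) (x : E) :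
    ‖(G₁ x - H₁ (Q₁ (G₁ x)) - G₁ (D₁ (R₁ (Ds₁ (G₁ x))))) - (G₂ x - H₂ (Q₂ (G₂ x)) - G₂ (D₂ (R₂ (Ds₂ (G₂ x)))))‖ ≤
      (δG + (δH * MQ * CG + CH * δQ * CG + CH * MQ * δG) +
        (δG * MD * MD * CG + CG * δD * MD * CG + CG * MD * δR * MD * CG + CG * MD * δD * CG + CG * MD * MD * δG)) * ‖x‖ := by
  have hG₁x : ‖G₁ x‖ ≤ CG * ‖x‖ := hG₁ x
  -- the `H₁QG₁` bracket
  have hHQG : ‖H₁ (Q₁ (G₁ x)) - H₂ (Q₂ (G₂ x))‖ ≤ (δH * MQ * CG + CH * δQ * CG + CH * MQ * δG) * ‖x‖ := by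
    have hsplit : H₁ (Q₁ (G₁ x)) - H₂ (Q₂ (G₂ x)) =
        (H₁ (Q₁ (G₁ x)) - H₂ (Q₁ (G₁ x))) + H₂ (Q₁ (G₁ x) - Q₂ (G₁ x)) + H₂ (Q₂ (G₁ x - G₂ x)) := by
      simp only [map_sub]; abel
    rw [hsplit]
    have hQG : ‖Q₁ (G₁ x)‖ ≤ MQ * (CG * ‖x‖) := (hQ₁ _).trans (mul_le_mul_of_nonneg_left hG₁x hMQ)
    have h1 : ‖H₁ (Q₁ (G₁ x)) - H₂ (Q₁ (G₁ x))‖ ≤ δH * MQ * CG * ‖x‖ :=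
      calc _ ≤ δH * ‖Q₁ (G₁ x)‖ := hδH _
        _ ≤ δH * (MQ * (CG * ‖x‖)) := mul_le_mul_of_nonneg_left hQG hδH0
        _ = δH * MQ * CG * ‖x‖ := by ring
    have h2 : ‖H₂ (Q₁ (G₁ x) - Q₂ (G₁ x))‖ ≤ CH * δQ * CG * ‖x‖ :=
      calc _ ≤ CH * ‖Q₁ (G₁ x) - Q₂ (G₁ x)‖ := hH₂ _
        _ ≤ CH * (δQ * (CG * ‖x‖)) := mul_le_mul_of_nonneg_left ((hδQ _).trans (mul_le_mul_of_nonneg_left hG₁x hδQ0)) hCH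
        _ = CH * δQ * CG * ‖x‖ := by ring
    have h3 : ‖H₂ (Q₂ (G₁ x - G₂ x))‖ ≤ CH * MQ * δG * ‖x‖ :=
      calc _ ≤ CH * ‖Q₂ (G₁ x - G₂ x)‖ := hH₂ _
        _ ≤ CH * (MQ * (δG * ‖x‖)) := mul_le_mul_of_nonneg_left ((hQ₂ _).trans (mul_le_mul_of_nonneg_left (hδG x) hMQ)) hCH
        _ = CH * MQ * δG * ‖x‖ := by ring
    calc _ ≤ ‖H₁ (Q₁ (G₁ x)) - H₂ (Q₁ (G₁ x))‖ + ‖H₂ (Q₁ (G₁ x) - Q₂ (G₁ x))‖ + ‖H₂ (Q₂ (G₁ x - G₂ x))‖ := norm_add₃_le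
      _ ≤ δH * MQ * CG * ‖x‖ + CH * δQ * CG * ‖x‖ + CH * MQ * δG * ‖x‖ := add_le_add (add_le_add h1 h2) h3
      _ = _ := by ring
  -- the `G₁DRD*G₁` bracket
  have hGDRDG : ‖G₁ (D₁ (R₁ (Ds₁ (G₁ x)))) - G₂ (D₂ (R₂ (Ds₂ (G₂ x))))‖ ≤
      (δG * MD * MD * CG + CG * δD * MD * CG + CG * MD * δR * MD * CG + CG * MD * δD * CG + CG * MD * MD * δG) * ‖x‖ := by
    have hsplit : G₁ (D₁ (R₁ (Ds₁ (G₁ x)))) - G₂ (D₂ (R₂ (Ds₂ (G₂ x)))) =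
        (G₁ (D₁ (R₁ (Ds₁ (G₁ x)))) - G₂ (D₁ (R₁ (Ds₁ (G₁ x))))) + G₂ (D₁ (R₁ (Ds₁ (G₁ x))) - D₂ (R₁ (Ds₁ (G₁ x)))) +
          G₂ (D₂ (R₁ (Ds₁ (G₁ x)) - R₂ (Ds₁ (G₁ x)))) + G₂ (D₂ (R₂ (Ds₁ (G₁ x) - Ds₂ (G₁ x)))) + G₂ (D₂ (R₂ (Ds₂ (G₁ x - G₂ x)))) := by
      simp only [map_sub]; abel
    rw [hsplit]
    have hDsG : ‖Ds₁ (G₁ x)‖ ≤ MD * (CG * ‖x‖) := (hDs₁ _).trans (mul_le_mul_of_nonneg_left hG₁x hMD)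
    have hRDsG : ‖R₁ (Ds₁ (G₁ x))‖ ≤ MD * (CG * ‖x‖) := (hR₁ _).trans hDsG
    have hDRDsG : ‖D₁ (R₁ (Ds₁ (G₁ x)))‖ ≤ MD * (MD * (CG * ‖x‖)) := (hD₁ _).trans (mul_le_mul_of_nonneg_left hRDsG hMD)
    have h1 : ‖G₁ (D₁ (R₁ (Ds₁ (G₁ x)))) - G₂ (D₁ (R₁ (Ds₁ (G₁ x))))‖ ≤ δG * MD * MD * CG * ‖x‖ :=
      calc _ ≤ δG * ‖D₁ (R₁ (Ds₁ (G₁ x)))‖ := hδG _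
        _ ≤ δG * (MD * (MD * (CG * ‖x‖))) := mul_le_mul_of_nonneg_left hDRDsG hδG0
        _ = δG * MD * MD * CG * ‖x‖ := by ring
    have h2 : ‖G₂ (D₁ (R₁ (Ds₁ (G₁ x))) - D₂ (R₁ (Ds₁ (G₁ x))))‖ ≤ CG * δD * MD * CG * ‖x‖ :=
      calc _ ≤ CG * ‖D₁ (R₁ (Ds₁ (G₁ x))) - D₂ (R₁ (Ds₁ (G₁ x)))‖ := hG₂ _
        _ ≤ CG * (δD * (MD * (CG * ‖x‖))) := mul_le_mul_of_nonneg_left ((hδD _).trans (mul_le_mul_of_nonneg_left hRDsG hδD0)) hCG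
        _ = CG * δD * MD * CG * ‖x‖ := by ring
    have h3 : ‖G₂ (D₂ (R₁ (Ds₁ (G₁ x)) - R₂ (Ds₁ (G₁ x))))‖ ≤ CG * MD * δR * MD * CG * ‖x‖ :=
      calc _ ≤ CG * ‖D₂ (R₁ (Ds₁ (G₁ x)) - R₂ (Ds₁ (G₁ x)))‖ := hG₂ _
        _ ≤ CG * (MD * (δR * (MD * (CG * ‖x‖)))) := mul_le_mul_of_nonneg_left ((hD₂ _).trans
            (mul_le_mul_of_nonneg_left ((hδR _).trans (mul_le_mul_of_nonneg_left hDsG hδR0)) hMD)) hCG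
        _ = CG * MD * δR * MD * CG * ‖x‖ := by ring
    have h4 : ‖G₂ (D₂ (R₂ (Ds₁ (G₁ x) - Ds₂ (G₁ x))))‖ ≤ CG * MD * δD * CG * ‖x‖ :=
      calc _ ≤ CG * ‖D₂ (R₂ (Ds₁ (G₁ x) - Ds₂ (G₁ x)))‖ := hG₂ _
        _ ≤ CG * (MD * (δD * (CG * ‖x‖))) := mul_le_mul_of_nonneg_left ((hD₂ _).trans (mul_le_mul_of_nonneg_left
            ((hR₂ _).trans ((hδDs _).trans (mul_le_mul_of_nonneg_left hG₁x hδD0))) hMD)) hCG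
        _ = CG * MD * δD * CG * ‖x‖ := by ring
    have h5 : ‖G₂ (D₂ (R₂ (Ds₂ (G₁ x - G₂ x))))‖ ≤ CG * MD * MD * δG * ‖x‖ :=
      calc _ ≤ CG * ‖D₂ (R₂ (Ds₂ (G₁ x - G₂ x)))‖ := hG₂ _
        _ ≤ CG * (MD * (MD * (δG * ‖x‖))) := mul_le_mul_of_nonneg_left ((hD₂ _).trans (mul_le_mul_of_nonneg_left
            ((hR₂ _).trans ((hDs₂ _).trans (mul_le_mul_of_nonneg_left (hδG x) hMD))) hMD)) hCG
        _ = CG * MD * MD * δG * ‖x‖ := by ring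
    calc _ ≤ ‖G₁ (D₁ (R₁ (Ds₁ (G₁ x)))) - G₂ (D₁ (R₁ (Ds₁ (G₁ x))))‖ + ‖G₂ (D₁ (R₁ (Ds₁ (G₁ x))) - D₂ (R₁ (Ds₁ (G₁ x))))‖ +
          ‖G₂ (D₂ (R₁ (Ds₁ (G₁ x)) - R₂ (Ds₁ (G₁ x))))‖ + ‖G₂ (D₂ (R₂ (Ds₁ (G₁ x) - Ds₂ (G₁ x))))‖ + ‖G₂ (D₂ (R₂ (Ds₂ (G₁ x - G₂ x))))‖ := by
          refine (norm_add_le _ _).trans (add_le_add ((norm_add_le _ _).trans (add_le_add norm_add₃_le le_rfl)) le_rfl)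
      _ ≤ δG * MD * MD * CG * ‖x‖ + CG * δD * MD * CG * ‖x‖ + CG * MD * δR * MD * CG * ‖x‖ + CG * MD * δD * CG * ‖x‖ +
          CG * MD * MD * δG * ‖x‖ := add_le_add (add_le_add (add_le_add (add_le_add h1 h2) h3) h4) h5
      _ = _ := by ring
  -- total
  have hsplit : (G₁ x - H₁ (Q₁ (G₁ x)) - G₁ (D₁ (R₁ (Ds₁ (G₁ x))))) - (G₂ x - H₂ (Q₂ (G₂ x)) - G₂ (D₂ (R₂ (Ds₂ (G₂ x))))) =
      (G₁ x - G₂ x) - (H₁ (Q₁ (G₁ x)) - H₂ (Q₂ (G₂ x))) - (G₁ (D₁ (R₁ (Ds₁ (G₁ x)))) - G₂ (D₂ (R₂ (Ds₂ (G₂ x))))) := by abel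
  rw [hsplit]
  calc _ ≤ ‖G₁ x - G₂ x‖ + ‖H₁ (Q₁ (G₁ x)) - H₂ (Q₂ (G₂ x))‖ + ‖G₁ (D₁ (R₁ (Ds₁ (G₁ x)))) - G₂ (D₂ (R₂ (Ds₂ (G₂ x))))‖ :=
        (norm_sub_le _ _).trans (add_le_add (norm_sub_le _ _) le_rfl)
    _ ≤ δG * ‖x‖ + (δH * MQ * CG + CH * δQ * CG + CH * MQ * δG) * ‖x‖ +
        (δG * MD * MD * CG + CG * δD * MD * CG + CG * MD * δR * MD * CG + CG * MD * δD * CG + CG * MD * MD * δG) * ‖x‖ :=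
        add_le_add (add_le_add (hδG x) hHQG) hGDRDG
    _ = _ := by ring

end FrakG

end Literature.MathematicalPhysics.QuantumFieldTheory.Balaban1983to89.B9Eq386ResolventLetters

end
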